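import Literature.Computability.Complexity.GateEliminationCase54Quad
import Literature.Computability.Complexity.GateEliminationKResynth
import Literature.Computability.Complexity.GateEliminationCase54Affine

/-!
# Gate elimination: Case 5.4.1.4.1.1 of Li–Yang's Theorem 4.1

"If `B` is a `1`-gate, then we can substitute appropriate constants to `y` and `z` such that `G`,
`D` and `E` are all trivialized. Then the out-degree of `B` will be reduced to `0`, hence can be
removed by Rule 1. All of these will make `x` a `0`-variable, so we make `3` variables
non-influential by `2` substitutions, resulting in `Δμ ≥ 3α_I/2 ≥ δ` [per substitution]."
(ECCC TR21-023, §4.1, Case 5.4.1.4.1.1; the paper's `z` is our `u`.) PROVED here as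
`stepGoal_quad11` (hypothesis `hQ11` of `stepGoal_quadratic_aux`).

## References

* J. Li, T. Yang, *3.1n − o(n) circuit lower bounds for explicit functions*, STOC 2022;
  ECCC TR21-023, §4.1 (Case 5.4.1.4.1.1), Lemma 3.11.
-/

namespace Literature.Computability.Complexity

open Finset

/-- `2δ ≤ 3α_I` (from the term `α_I/3` of `δ`). [cite: LiYang2022, Lemma 3.11 / proof of Thm. 1.1] -/
theorem two_liYangDelta_le_three (αφ : ℝ) {αI : ℝ} (hI : 0 ≤ αI) (αQ : ℝ) : 2 * liYangDelta αφ αI αQ ≤ 3 * αI := by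
  unfold liYangDelta
  have : min (αI / 3) (min (2 - 2 * αφ + αQ) (min (4 - 4 * αφ) (min (3 + αφ) (min (5 - αQ) ((5 - 2 * αφ + αQ) / 2))))) ≤
      αI / 3 := min_le_left _ _
  linarith

namespace Semicircuit

variable {n : ℕ} {C : Semicircuit n} {k₀ : Fin C.m} {f : (Fin n → ZMod 2) → Bool} {R : RdqSource n} {d : ℕ}
  {αφ αI αQ : ℝ} {P : Finset (Fin C.m × Fin C.m)} {G : Fin C.m} {x y : Fin n} {B C' D : Fin C.m} {aX aB aC aD : Fin 2}

/-- The gate functions after a trivialized gate is eliminated are unchanged. [folklore] -/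
theorem elimDataWTriv_op (hF : C.Fair) (hC : C.ComputesRestr f R) (hP : C.IsPacking P) {a₀ : Fin 2} {b₀ : Bool}
    (h₀ : C.arg k₀ a₀ = .const b₀) (htriv : C.liveFn k₀ a₀ b₀ false = C.liveFn k₀ a₀ b₀ true) (hout : C.out ≠ .gate k₀)
    (hφ : 0 ≤ αφ) (hI : 0 ≤ αI) (αQ : ℝ) (k' : Fin (elimDataWTriv hF hC hP h₀ htriv hout hφ hI αQ).C'.m) :
    (elimDataWTriv hF hC hP h₀ htriv hout hφ hI αQ).C'.op k' = C.op ((elimDataWTriv hF hC hP h₀ htriv hout hφ hI αQ).ι k') := by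
  funext p q
  show C.op _ (p ^^ (false && _)) (q ^^ (false && _)) = C.op _ p q
  rw [Bool.false_and, Bool.false_and, Bool.xor_false, Bool.xor_false]
  rfl

/-- **Case 5.4.1.4.1.1 of the proof of Thm. 4.1**: `E` (∧-type, reading `D` at `aE`) reads the
non-∧-type `1`-gate `B = B(x, t)`; substitute the killing constant to `y` (trivializing `G`), then
a constant to `u` making `D` the constant killing `E`; eliminate `G`, `D`, `E`, and the `0`-gate
`B` (Rule 1): `x`, `y`, `u` leave the influential set, `Δμ ≥ 3α_I ≥ 2δ`. [cite: LiYang2022, §4.1 (Case 5.4.1.4.1.1)] -/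
theorem stepGoal_quad11 (hf : IsAffineDisperser f d) (hd : 2 * d + 2 < R.dim) (hF : C.Fair)
    (hC : C.ComputesRestr f R) (hS : C.Standing R) (hcfg : C.Case5Config G x y B C' D aX aB aC aD)
    (hφ0 : 0 < αφ) (hφ : αφ < 1 / 2) (hI0 : 0 < αI) (hBC : B ≠ C')
    {E : Fin C.m} {aE : Fin 2} {u : Fin n} (hDn : ¬ IsAndOp (C.op D)) (hIu : C.arg D aD.rev = .var u)
    (hup : ¬ R.Protected u) (hu1 : C.fanout (.var u) = 1)
    (hEand : IsAndOp (C.op E)) (hED : C.arg E aE = .gate D)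
    {t : Fin n} (hEB : C.arg E aE.rev = .gate B) (hBt : C.arg B aB.rev = .var t) (hB1 : C.fanout (.gate B) = 1)
    (ht2 : C.fanout (.var t) = 2) :
    C.StepGoal f R αφ αI αQ := by
  classical
  have hφ' := hφ0.le
  have hI' := hI0.le
  have hN := hS.normalized.1
  have hGK := hcfg.G_not_mem
  have hDK : D ∉ C.xorPart := fun hDK => hGK (C.mem_of_arg_eq D hDK aD G hcfg.arg_D)
  have hEK : E ∉ C.xorPart := C.not_mem_xorPart_of_isAndOp hEand
  have hBx := hcfg.arg_B
  obtain ⟨dD, hdD⟩ : IsXorOp (C.op D) := C.isXorOp_of_isAffineOp hS.nonDegenerate ((isAndOp_or_isAffineOp _).resolve_left hDn)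
  have hux : u ≠ x := fun h => case5_D_not_x hS hcfg aD.rev (by rw [hIu, h])
  have huy : u ≠ y := fun h => case5_D_not_y hS hcfg aD.rev (by rw [hIu, h])
  have hED' : E ≠ D := fun h => by rw [h] at hED; exact C.arg_ne_self_of_not_mem hDK _ hED
  have hEG : E ≠ G := by
    intro h; rw [h] at hED
    rcases fin2_eq_or_eq_rev aX aE with e' | e'
    · rw [e', hcfg.arg_G_x] at hED; cases hED
    · rw [e', hcfg.arg_G_y] at hED; cases hED
  have hEB' : E ≠ B := by
    intro h; rw [h] at hED
    rcases fin2_eq_or_eq_rev aB aE with e' | e'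
    · rw [e', hBx] at hED; cases hED
    · rw [e', hBt] at hED; cases hED
  have hBD : B ≠ D := case5_B_ne_D hS hcfg
  have hBG := hcfg.B_ne_G
  have hDG := hcfg.D_ne_G
  have hE_y : ∀ a, C.arg E a ≠ .var y := by
    intro a h
    rcases fin2_eq_or_eq_rev aE a with e' | e'
    · rw [e', hED] at h; cases h
    · rw [e', hEB] at h; cases h
  have hE_u : ∀ a, C.arg E a ≠ .var u := by
    intro a h
    rcases fin2_eq_or_eq_rev aE a with e' | e'
    · rw [e', hED] at h; cases h
    · rw [e', hEB] at h; cases h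
  have hD_y : ∀ a, C.arg D a ≠ .var y := by
    intro a h
    rcases fin2_eq_or_eq_rev aD a with e' | e'
    · rw [e', hcfg.arg_D] at h; cases h
    · rw [e', hIu] at h; cases h; exact huy rfl
  have hB_y : ∀ a, C.arg B a ≠ .var y := fun a => case5_B_not_y hcfg hBC a
  have hty : t ≠ y := fun h => hB_y aB.rev (by rw [hBt, h])
  have htx : t ≠ x := by
    intro h
    have e : ∀ a', C.arg B a' = .var x := fun a' => by
      rcases fin2_eq_or_eq_rev aB a' with h' | h'
      · rw [h']; exact hBx
      · rw [h', hBt, h]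
    exact hN.arg_zero_ne_arg_one B (by rw [e 0, e 1])
  have hx : R.Free x := case5_free_x hC hcfg
  have hxp : ¬ R.Protected x := case5_unprot_x hS hcfg
  have hy : R.Free y := free_of_reads hC hcfg.arg_G_y
  have hyp : ¬ R.Protected y := case5_unprot_y hS hcfg
  have hu : R.Free u := free_of_reads hC hIu
  have hDout : C.out ≠ .gate D := out_ne_of_read_bYacyclic hS hEK ⟨aE, hED⟩
  have hBout : C.out ≠ .gate B := out_ne_of_read_bYacyclic hS hEK ⟨aE.rev, hEB⟩
  have hGout : C.out ≠ .gate G := out_ne_of_read_bYacyclic hS hDK ⟨aD, hcfg.arg_D⟩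
  obtain ⟨ko, hko⟩ := exists_out_eq_gate' hf hF hC (by omega)
  -- the only reader of `B` is `E`
  have honlyB : ∀ k a, C.arg k a = .gate B → k = E := by
    intro k a h
    by_contra hk
    have := two_le_fanout hEB h (fun h' => hk h'.symm); omega
  -- step 1: `y := cy`, the killing constant of `G`
  obtain ⟨cy, hcy⟩ := exists_trivializing hcfg.and_G aX.rev
  let cy' : ZMod 2 := finTwoEquiv.symm cy
  have hcy' : finTwoEquiv cy' = cy := finTwoEquiv.apply_symm_apply cy
  let C₁ := C.substConst y (finTwoEquiv cy')
  let R₁ := R.assignFree y cy' hy hyp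
  have hF₁ : C₁.Fair := hF.substConst y _
  have hC₁ : C₁.ComputesRestr f R₁ := hC.substConst_assignFree hy hyp cy'
  have hP₁ : C₁.IsPacking (C.substConstPacking y (finTwoEquiv cy') ∅) := C.isPacking_empty.substConst
  have hd₁ : 2 * d + 2 ≤ R₁.dim := by have := RdqSource.dim_assignFree (b := cy') hy hyp; change R₁.dim + 1 = R.dim at this; omega
  have hC₁var : ∀ {k : Fin C.m} {a : Fin 2} {v : Fin n}, v ≠ y → (C₁.arg k a = .var v ↔ C.arg k a = .var v) := by
    intro k a v hvy
    show (C.arg k a).substConst y _ = .var v ↔ _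
    cases hka : C.arg k a with
    | const c => exact ⟨(fun h => by cases h), fun h => by cases h⟩
    | var i =>
      by_cases hiy : i = y
      · rw [hiy, Node.substConst_var_self]; exact ⟨(fun h => by cases h), fun h => by cases h; exact absurd rfl hvy⟩
      · rw [Node.substConst_var_of_ne hiy]
    | gate g => exact ⟨(fun h => by cases h), fun h => by cases h⟩
  have hC₁gate : ∀ {k : Fin C.m} {a : Fin 2} {g : Fin C.m}, C₁.arg k a = .gate g ↔ C.arg k a = .gate g :=
    fun {k a g} => Node.substConst_eq_gate_iff
  have hGy₁ : C₁.arg G aX.rev = .const cy := by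
    show (C.arg G aX.rev).substConst y _ = _; rw [hcfg.arg_G_y, Node.substConst_var_self, hcy']
  have hGx₁ : C₁.arg G aX = .var x := (hC₁var (fun h => hcfg.x_ne_y h)).mpr hcfg.arg_G_x
  have htrivG : C₁.liveFn G aX.rev cy false = C₁.liveFn G aX.rev cy true := hcy
  have hC₁out : C₁.out = .gate ko := by show C.out.substConst y _ = _; rw [hko]; rfl
  have hout₁G : C₁.out ≠ .gate G := by rw [hC₁out]; exact fun h => hGout (by rw [hko]; exact h)
  let E₁ := elimDataWTriv hF₁ hC₁ hP₁ hGy₁ htrivG hout₁G hφ' hI' αQ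
  set cG := C₁.liveFn G aX.rev cy false with hcG
  have hr₁ : E₁.repl = .const cG := rfl
  obtain ⟨kD₁, hkD₁⟩ := E₁.ι_surj D hDG
  obtain ⟨kE₁, hkE₁⟩ := E₁.ι_surj E hEG
  obtain ⟨kB₁, hkB₁⟩ := E₁.ι_surj B hBG
  have hD₁c : E₁.C'.arg kD₁ aD = .const cG :=
    (E₁.arg_eq_const_iff kD₁ aD cG).mpr (Or.inr ⟨by rw [hkD₁]; exact hC₁gate.mpr hcfg.arg_D, hr₁⟩)
  have hD₁u : E₁.C'.arg kD₁ aD.rev = .var u := by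
    rw [E₁.arg_eq_var_iff, hkD₁]; exact Or.inl ((hC₁var huy).mpr hIu)
  have hE₁D : E₁.C'.arg kE₁ aE = .gate kD₁ := by
    rw [E₁.arg_eq_gate_iff, hkE₁, hkD₁]; exact Or.inl (hC₁gate.mpr hED)
  have hE₁B : E₁.C'.arg kE₁ aE.rev = .gate kB₁ := by
    rw [E₁.arg_eq_gate_iff, hkE₁, hkB₁]; exact Or.inl (hC₁gate.mpr hEB)
  have hB₁x : E₁.C'.arg kB₁ aB = .var x := by rw [E₁.arg_eq_var_iff, hkB₁]; exact Or.inl ((hC₁var (fun h => hcfg.x_ne_y h)).mpr hBx)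
  have hB₁t : E₁.C'.arg kB₁ aB.rev = .var t := by rw [E₁.arg_eq_var_iff, hkB₁]; exact Or.inl ((hC₁var hty).mpr hBt)
  have hopD₁ : E₁.C'.op kD₁ = C.op D := by rw [elimDataWTriv_op, hkD₁]
  have hopE₁ : E₁.C'.op kE₁ = C.op E := by rw [elimDataWTriv_op, hkE₁]
  -- step 2: `u := cu` making `D` the killing constant `kE` of `E`
  obtain ⟨kE, hkE⟩ := exists_trivializing hEand aE
  let cu : Bool := (cG ^^ dD) ^^ kE
  let cu' : ZMod 2 := finTwoEquiv.symm cu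
  have hcu' : finTwoEquiv cu' = cu := finTwoEquiv.apply_symm_apply cu
  have hu₁ : R₁.Free u := (RdqSource.free_assignFree_iff hy hyp u).mpr ⟨hu, huy⟩
  have hup₁ : ¬ R₁.Protected u := fun h => hup ((RdqSource.protected_assignFree_iff hy hyp u).mp h)
  let C₂ := E₁.C'.substConst u (finTwoEquiv cu')
  let R₂ := R₁.assignFree u cu' hu₁ hup₁
  have hF₂ : C₂.Fair := E₁.fair.substConst u _
  have hC₂ : C₂.ComputesRestr f R₂ := E₁.computes.substConst_assignFree hu₁ hup₁ cu'
  have hP₂ : C₂.IsPacking (E₁.C'.substConstPacking u (finTwoEquiv cu') E₁.P') := E₁.packing.substConst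
  have hdim₂ : R₂.dim + 2 = R.dim := by
    have h1 := RdqSource.dim_assignFree (b := cu') hu₁ hup₁
    have h2 := RdqSource.dim_assignFree (b := cy') hy hyp
    change R₂.dim + 1 = R₁.dim at h1
    change R₁.dim + 1 = R.dim at h2
    omega
  have hD₂c : C₂.arg kD₁ aD = .const cG := by show (E₁.C'.arg kD₁ aD).substConst u _ = _; rw [hD₁c]; rfl
  have hD₂u : C₂.arg kD₁ aD.rev = .const cu := by show (E₁.C'.arg kD₁ aD.rev).substConst u _ = _; rw [hD₁u, Node.substConst_var_self, hcu']
  have hE₂D : C₂.arg kE₁ aE = .gate kD₁ := by show (E₁.C'.arg kE₁ aE).substConst u _ = _; rw [hE₁D]; rfl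
  have hE₂B : C₂.arg kE₁ aE.rev = .gate kB₁ := by show (E₁.C'.arg kE₁ aE.rev).substConst u _ = _; rw [hE₁B]; rfl
  have hB₂x : C₂.arg kB₁ aB = .var x := by show (E₁.C'.arg kB₁ aB).substConst u _ = _; rw [hB₁x, Node.substConst_var_of_ne hux.symm]
  have hB₂t : C₂.arg kB₁ aB.rev = .var t := by
    show (E₁.C'.arg kB₁ aB.rev).substConst u _ = _; rw [hB₁t, Node.substConst_var_of_ne (fun h => ?_)]
    rw [h] at hBt; have := two_le_fanout hIu hBt hBD.symm; omega
  -- `D` computes the constant `kE`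
  have hidD : ∀ (xx : Fin n → Bool) (w : Fin C₂.m → Bool),
      C₂.op kD₁ (C₂.nodeVal xx w (C₂.arg kD₁ 0)) (C₂.nodeVal xx w (C₂.arg kD₁ 1)) = kE := by
    intro xx w
    show E₁.C'.op kD₁ _ _ = kE
    rw [hopD₁, hdD]
    rcases fin2_eq_or_eq_rev 0 aD with e0 | e0
    · have h0 : C₂.arg kD₁ 0 = .const cG := by rw [← e0]; exact hD₂c
      have h1 : C₂.arg kD₁ 1 = .const cu := by rw [show (1 : Fin 2) = Fin.rev 0 from rfl, ← e0]; exact hD₂u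
      rw [h0, h1]; show ((cG ^^ ((cG ^^ dD) ^^ kE)) ^^ dD) = kE; cases cG <;> cases dD <;> cases kE <;> rfl
    · have e1 : aD = 1 := by rw [e0]; rfl
      have h1 : C₂.arg kD₁ 1 = .const cG := by rw [← e1]; exact hD₂c
      have h0 : C₂.arg kD₁ 0 = .const cu := by rw [show (0 : Fin 2) = Fin.rev 1 from rfl, ← e1]; exact hD₂u
      rw [h0, h1]; show ((((cG ^^ dD) ^^ kE) ^^ cG) ^^ dD) = kE; cases cG <;> cases dD <;> cases kE <;> rfl
  have hselfD : ∀ a, C₂.arg kD₁ a ≠ .gate kD₁ := by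
    intro a h
    rcases fin2_eq_or_eq_rev aD a with e' | e'
    · rw [e', hD₂c] at h; cases h
    · rw [e', hD₂u] at h; cases h
  have hout₂D : C₂.out ≠ .gate kD₁ :=
    out_ne_of_semConst hf (by omega) hF₂ hC₂ (fun xx w hw => by rw [hw kD₁]; exact hidD xx w)
  let E₂ := elimDataWRedirectConst hF₂ hC₂ hP₂ kE hidD (Or.inr ⟨aD, cG, hD₂c⟩) hselfD hout₂D hφ' hI' αQ
  have hr₂ : E₂.repl = .const kE := rfl
  have hkED₁ : kE₁ ≠ kD₁ := fun h => hED' (by rw [← hkE₁, ← hkD₁, h])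
  have hkBD₁ : kB₁ ≠ kD₁ := fun h => hBD (by rw [← hkB₁, ← hkD₁, h])
  have hkEB₁ : kE₁ ≠ kB₁ := fun h => hEB' (by rw [← hkE₁, ← hkB₁, h])
  obtain ⟨kE₂, hkE₂⟩ := E₂.ι_surj kE₁ hkED₁
  obtain ⟨kB₂, hkB₂⟩ := E₂.ι_surj kB₁ hkBD₁
  have hE₂c : E₂.C'.arg kE₂ aE = .const kE := (E₂.arg_eq_const_iff kE₂ aE kE).mpr (Or.inr ⟨by rw [hkE₂]; exact hE₂D, hr₂⟩)
  have hE₂B' : E₂.C'.arg kE₂ aE.rev = .gate kB₂ := by rw [E₂.arg_eq_gate_iff, hkE₂, hkB₂]; exact Or.inl hE₂B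
  have hB₂x' : E₂.C'.arg kB₂ aB = .var x := by rw [E₂.arg_eq_var_iff, hkB₂]; exact Or.inl hB₂x
  have hB₂t' : E₂.C'.arg kB₂ aB.rev = .var t := by rw [E₂.arg_eq_var_iff, hkB₂]; exact Or.inl hB₂t
  have hopE₂ : E₂.C'.op kE₂ = C.op E := by rw [elimDataWRedirectConst_op, hkE₂]; exact hopE₁
  -- step 3: `E` is trivialized
  have htrivE : E₂.C'.liveFn kE₂ aE kE false = E₂.C'.liveFn kE₂ aE kE true := by
    unfold liveFn at hkE ⊢; rw [hopE₂]; exact hkE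
  have hout₂E : E₂.C'.out ≠ .gate kE₂ := out_ne_of_trivialized hf (by omega) E₂.fair E₂.computes hE₂c htrivE
  let E₃ := elimDataWTriv E₂.fair E₂.computes E₂.packing hE₂c htrivE hout₂E hφ' hI' αQ
  have hr₃ : ∃ c₃, E₃.repl = .const c₃ := ⟨_, rfl⟩
  have hkBE₂ : kB₂ ≠ kE₂ := fun h => hkEB₁ (by rw [← hkE₂, ← hkB₂, h])
  obtain ⟨kB₃, hkB₃⟩ := E₃.ι_surj kB₂ hkBE₂
  have hB₃x : E₃.C'.arg kB₃ aB = .var x := by rw [E₃.arg_eq_var_iff, hkB₃]; exact Or.inl hB₂x'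
  have hB₃t : E₃.C'.arg kB₃ aB.rev = .var t := by rw [E₃.arg_eq_var_iff, hkB₃]; exact Or.inl hB₂t'
  -- step 4: `B` is a `0`-gate: delete it
  have hfB₁ : E₁.C'.fanout (.gate kB₁) = 1 := by
    rw [E₁.fanout_gate_eq (fun a h => ?_) (by rw [hr₁]; exact fun h => by cases h), hkB₁]
    · show (C.substConst y (finTwoEquiv cy')).fanout (.gate B) = 1; rw [C.fanout_substConst_gate]; exact hB1
    · rcases fin2_eq_or_eq_rev aX a with e' | e'
      · rw [e', hGx₁] at h; cases h
      · rw [e', hGy₁] at h; cases h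
  have hfB₂ : C₂.fanout (.gate kB₁) = 1 := by
    show (E₁.C'.substConst u (finTwoEquiv cu')).fanout (.gate kB₁) = 1; rw [E₁.C'.fanout_substConst_gate]; exact hfB₁
  have hfB₂' : E₂.C'.fanout (.gate kB₂) = 1 := by
    rw [E₂.fanout_gate_eq (fun a h => ?_) (by rw [hr₂]; exact fun h => by cases h), hkB₂, hfB₂]
    rcases fin2_eq_or_eq_rev aD a with e' | e'
    · rw [e', hD₂c] at h; cases h
    · rw [e', hD₂u] at h; cases h
  have hfB₃ : E₃.C'.fanout (.gate kB₃) = 0 := by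
    obtain ⟨c₃, hc₃⟩ := hr₃
    have h1 := E₃.fanout_gate_add (k' := kB₃) (by rw [hc₃]; exact fun h => by cases h)
    rw [hkB₃, hfB₂'] at h1
    have h2 : 1 ≤ (univ.filter fun a : Fin 2 => E₂.C'.arg kE₂ a = .gate kB₂).card :=
      card_pos.mpr ⟨aE.rev, mem_filter.mpr ⟨mem_univ _, hE₂B'⟩⟩
    omega
  have hno₅ : ∀ k a, E₃.C'.arg k a ≠ .gate kB₃ := (fanout_eq_zero_iff _ _).mp hfB₃
  -- the output is never one of the eliminated gates, so it is not `B`'s image either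
  have hC₂out : C₂.out = (E₁.C'.out).substConst u (finTwoEquiv cu') := rfl
  have hout₃B : E₃.C'.out ≠ .gate kB₃ := by
    intro h3
    have e3 := E₃.out_eq; rw [if_neg hout₂E, h3] at e3
    change Node.gate (E₃.ι kB₃) = E₂.C'.out at e3; rw [hkB₃] at e3
    have e2 := E₂.out_eq; rw [if_neg hout₂D, ← e3] at e2
    change Node.gate (E₂.ι kB₂) = C₂.out at e2; rw [hkB₂, hC₂out] at e2
    have e1 := E₁.out_eq; rw [if_neg hout₁G, hC₁out] at e1
    -- `E₁.out` is the image of `ko`; after `substConst` still a gate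
    cases h1o : E₁.C'.out with
    | const cc => rw [h1o] at e1; change Node.const cc = Node.gate ko at e1; cases e1
    | var i => rw [h1o] at e1; change Node.var i = Node.gate ko at e1; cases e1
    | gate g₁ =>
      rw [h1o] at e1 e2
      change Node.gate kB₁ = Node.gate g₁ at e2
      cases e2
      change Node.gate (E₁.ι kB₁) = Node.gate ko at e1
      rw [hkB₁] at e1; cases e1; exact hBout hko
  let ε₅ := E₃.C'.skipEquiv kB₃
  let C₅ := E₃.C'.removeGate kB₃ ε₅
  have hF₅ : C₅.Fair := E₃.fair.removeGate ε₅ hno₅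
  have hC₅ : C₅.ComputesRestr f R₂ := E₃.computes.removeGate ε₅ E₃.fair hno₅ hout₃B
  -- out-degrees of variables along the way
  have hfv₁ : ∀ v, v ≠ y → C₁.fanout (.var v) = C.fanout (.var v) := fun v hv => C.fanout_substConst_var_of_ne y _ hv
  have hfvE₁ : ∀ v, E₁.C'.fanout (.var v) ≤ C₁.fanout (.var v) := by
    intro v; have h1 := E₁.fanout_var_add (i := v) (by rw [hr₁]; exact fun h => by cases h); omega
  have hfv₂ : ∀ v, v ≠ u → C₂.fanout (.var v) = E₁.C'.fanout (.var v) := fun v hv => E₁.C'.fanout_substConst_var_of_ne u _ hv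
  have hfvE₂ : ∀ v, E₂.C'.fanout (.var v) ≤ C₂.fanout (.var v) := by
    intro v; have h1 := E₂.fanout_var_add (i := v) (by rw [hr₂]; exact fun h => by cases h); omega
  have hfvE₃ : ∀ v, E₃.C'.fanout (.var v) ≤ E₂.C'.fanout (.var v) := by
    intro v; obtain ⟨c₃, hc₃⟩ := hr₃
    have h1 := E₃.fanout_var_add (i := v) (by rw [hc₃]; exact fun h => by cases h); omega
  have hfx₁ : E₁.C'.fanout (.var x) = 1 := by
    have h1 := E₁.fanout_var_add (i := x) (by rw [hr₁]; exact fun h => by cases h)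
    have h2 : (univ.filter fun a : Fin 2 => C₁.arg G a = .var x).card = 1 := by
      rw [card_eq_one]; refine ⟨aX, ?_⟩; ext a; rw [mem_filter, mem_singleton]
      constructor
      · intro ⟨_, h⟩
        rcases fin2_eq_or_eq_rev aX a with e' | e'
        · exact e'
        · rw [e', hGy₁] at h; cases h
      · intro h; rw [h]; exact ⟨mem_univ _, hGx₁⟩
    rw [h2, hfv₁ x (fun h => hcfg.x_ne_y h), hcfg.fanout_x] at h1; omega
  have hvarB : ∀ a v, E₃.C'.arg kB₃ a = .var v → E₃.C'.fanout (.var v) ≤ 2 := by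
    intro a v hv
    rcases fin2_eq_or_eq_rev aB a with e' | e'
    · rw [e', hB₃x] at hv; cases hv
      have := hfvE₃ x; have := hfvE₂ x; have := hfv₂ x hux.symm; omega
    · rw [e', hB₃t] at hv; cases hv
      have h4 : t ≠ u := fun h => by rw [h] at hBt; have := two_le_fanout hIu hBt hBD.symm; omega
      have := hfvE₃ t; have := hfvE₂ t; have := hfv₂ t h4; have := hfvE₁ t; have := hfv₁ t hty; omega
  have hgateB : ∀ a g, E₃.C'.arg kB₃ a = .gate g → E₃.C'.fanout (.gate g) ≤ 1 := by
    intro a g hg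
    rcases fin2_eq_or_eq_rev aB a with e' | e'
    · rw [e', hB₃x] at hg; cases hg
    · rw [e', hB₃t] at hg; cases hg
  obtain ⟨P₅, hP₅, hpot₅⟩ := exists_packing_removeGate_noNew E₃.C' kB₃ ε₅ hno₅ E₃.packing hvarB hgateB
  -- `x` is a `0`-variable at the end
  have hfx₅ : C₅.fanout (.var x) = 0 := by
    have h1 := E₃.C'.fanout_removeGate_add kB₃ ε₅ hno₅ (v := .var x) (fun h => by cases h)
    have h2 : 1 ≤ (univ.filter fun a : Fin 2 => E₃.C'.arg kB₃ a = .var x).card :=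
      card_pos.mpr ⟨aB, mem_filter.mpr ⟨mem_univ _, hB₃x⟩⟩
    change C₅.fanout (.var x) + _ = _ at h1
    have := hfvE₃ x; have := hfvE₂ x; have := hfv₂ x hux.symm
    omega
  have hxp₂ : ¬ R₂.Protected x := fun h =>
    hxp ((RdqSource.protected_assignFree_iff hy hyp x).mp ((RdqSource.protected_assignFree_iff hu₁ hup₁ x).mp h))
  have hxinf₃ : x ∈ E₃.C'.influential R₂ := E₃.C'.mem_influential_of_reads R₂ hB₃x
  have hinf₅ : ((C₅.influential R₂).card : ℝ) + 1 ≤ (E₃.C'.influential R₂).card := by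
    have hsub : C₅.influential R₂ ⊆ (E₃.C'.influential R₂).erase x := by
      intro i hi
      rw [mem_erase]
      refine ⟨fun hix => ?_, E₃.C'.influential_removeGate_subset kB₃ ε₅ hno₅ R₂ hi⟩
      rw [hix] at hi
      unfold influential at hi; rw [mem_filter, hfx₅] at hi
      rcases hi.2 with h | h
      · omega
      · exact hxp₂ h
    have h1 := card_le_card hsub
    have h2 := card_erase_add_one hxinf₃
    have : (C₅.influential R₂).card + 1 ≤ (E₃.C'.influential R₂).card := by omega
    exact_mod_cast this
  -- accounting: `y`, `u`, `x` leave the influential set; every elimination has a nonnegative gain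
  have hyinf : y ∈ C.influential R := C.mem_influential_of_reads R hcfg.arg_G_y
  have hμ₁ := measure_substConst_le hφ' αI αQ C.isPacking_empty R R₁ y (finTwoEquiv cy')
  have hinf₁ : (1 : ℝ) ≤ ((C.influential R).card : ℝ) - (C₁.influential R₁).card := by
    have h1 : (C₁.influential R₁).card ≤ ((C.influential R).erase y).card :=
      card_le_card (C.influential_substConst_assignFree_subset hy hyp cy' (finTwoEquiv cy'))
    have h3 := card_erase_add_one hyinf
    have : (C₁.influential R₁).card + 1 ≤ (C.influential R).card := by omega
    have : ((C₁.influential R₁).card : ℝ) + 1 ≤ (C.influential R).card := by exact_mod_cast this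
    linarith
  have hq₁ : ((R.quadCount : ℝ) - (R₁.quadCount : ℝ)) = 0 := by
    have : R₁.quadCount = R.quadCount := RdqSource.quadCount_assignFree hy hyp; rw [this]; ring
  have hμE₁ := E₁.measure_le
  have huinf₁ : u ∈ E₁.C'.influential R₁ := E₁.C'.mem_influential_of_reads R₁ hD₁u
  have hμ₂ := measure_substConst_le hφ' αI αQ E₁.packing R₁ R₂ u (finTwoEquiv cu')
  have hinf₂ : (1 : ℝ) ≤ ((E₁.C'.influential R₁).card : ℝ) - (C₂.influential R₂).card := by
    have h1 : (C₂.influential R₂).card ≤ ((E₁.C'.influential R₁).erase u).card :=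
      card_le_card (E₁.C'.influential_substConst_assignFree_subset hu₁ hup₁ cu' (finTwoEquiv cu'))
    have h3 := card_erase_add_one huinf₁
    have : (C₂.influential R₂).card + 1 ≤ (E₁.C'.influential R₁).card := by omega
    have : ((C₂.influential R₂).card : ℝ) + 1 ≤ (E₁.C'.influential R₁).card := by exact_mod_cast this
    linarith
  have hq₂ : ((R₁.quadCount : ℝ) - (R₂.quadCount : ℝ)) = 0 := by
    have : R₂.quadCount = R₁.quadCount := RdqSource.quadCount_assignFree hu₁ hup₁; rw [this]; ring
  have hμE₂ := E₂.measure_le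
  have hμE₃ := E₃.measure_le
  have hm₅ : (C₅.m : ℝ) + 1 = E₃.C'.m := by exact_mod_cast E₃.C'.removeGate_m_add_one kB₃ ε₅
  have hpot₅' : (C₅.potential P₅ : ℝ) ≤ E₃.C'.potential E₃.P' := by exact_mod_cast hpot₅
  have hμ₅ : C₅.measure αφ αI αQ P₅ R₂ ≤ E₃.C'.measure αφ αI αQ E₃.P' R₂ - 1 - αI := by
    unfold measure
    nlinarith [mul_le_mul_of_nonneg_left hinf₅ hI', mul_le_mul_of_nonneg_left hpot₅' hφ']
  refine Or.inr ⟨2, by norm_num, by norm_num, C₅, R₂, P₅, hF₅, hC₅, hP₅, hdim₂, ?_⟩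
  have hδ := two_liYangDelta_le_three αφ hI' αQ
  rw [hq₁] at hμ₁; rw [hq₂] at hμ₂
  have hαI₁ := mul_le_mul_of_nonneg_left hinf₁ hI'
  have hαI₂ := mul_le_mul_of_nonneg_left hinf₂ hI'
  push_cast
  nlinarith [hμ₁, hμE₁, hμ₂, hμE₂, hμE₃, hμ₅, hαI₁, hαI₂, hφ.le]

end Semicircuit

end Literature.Computability.Complexity
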